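import Summits.AtomisticToContinuum.HydrodynamicLimit.Theorems.RelayRaceLocalityNearConstantShortTimeHLTiltL2Defs
import Summits.AtomisticToContinuum.HydrodynamicLimit.Theorems.RelayRaceLocalityNearConstantShortTimeHLGeneralFamilyConcentrationContraction
import Summits.AtomisticToContinuum.HydrodynamicLimit.Theorems.CollisionIsometryCLTMesoscopicLLNTreeBound
import Summits.AtomisticToContinuum.HydrodynamicLimit.Theorems.BoxDissipativeWeakStrongLocalGibbsFineScaleTreeL1
import HarnessLib

/-!
# Crux `NearConstantShortTimeHL` (stmt-AtomisticToContinuum-12502), line `small-tilt-domination` —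
# registered helper `tl_varianceL2_of : OnePointShift → SameBlockL2 → VarianceL2`

Support file (`--supports stmt-AtomisticToContinuum-12502`). THE `L²` VARIANCE BOUND for linear statistics `S = Σᵢ g(xᵢ)` of
the canonical dilute hard-sphere gas of `n` labels at scale `ε` with one-particle law `μ_P` (`VarianceL2` of `…TiltL2Defs`):
`Ξ(n)⁻¹ ∫ (S - n A)² 𝟙[hard core] dμ^{⊗n} ≤ K n ∫ g² dμ`, `A = A(n)`, `A(m) = M^g(m)/Ξ(m)`, under `n p_ε ≤ λ₀`. Proof: the
variance identity of the tree (`variance_identity`) gives `LHS = n E[g(x₀)²] + (n² - n)(T - A²) - n A²`, `T = E[g(x₀)g(x₁)]`;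
`E[g²] ≤ 2∫g² dμ` (Ruelle, `LGFS.Md_le_integral_mul_Xi`); and `Ξ(n)(T - A²) = Σ_{j<n-1} C(n-2,j) W(j+1) Ξ(n-1-j) [A(n-1-j) - A(n)]
+ sbr(g,g) - A sbr(g,1)` by the two-point decorated expansion `integral_two_point_eq` applied to `(g, g)` AND to `(g, 1)` (the
latter expands `M^g(n)` over the blocks of `0` avoiding `1`). The first sum is `O((∫|g|)² Ξ(n)/n)` by the `L¹` tree bound at the
root (`MesoLLN.abs_Wd_le_integral`), `Ξ(n-1-j) ≤ 2^{j+1} Ξ(n)` and the hypothesis `OnePointShift` telescoped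
(`n |A(n) - A(n-1-j)| ≤ K'(∫|g|)(j+1)(j+2)`); the same-block remainders are `O(p_ε Ξ(n))` times `∫ g²` (hypothesis
`SameBlockL2`) resp. `∫|g|` (`LGFS.abs_sameBlockRem_le_L1`); all `j`-sums are dominated by `Σ (j+1)(j+2)(2eλ)ʲ ≤ 4`
(`λ ≤ 1/50`), and `(∫|g| dμ)² ≤ ∫ g² dμ`.
References: E. Pulvirenti – D. Tsagkarogiannis, Comm. Math. Phys. 316 (2012) Thm 2.1, §3–5; D. Ruelle, Statistical Mechanics
(1969) §4.2.
-/

noncomputable section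

namespace Summit.AtomisticToContinuum.HydrodynamicLimit.Theorems.NearConstantShortTimeHL

open MeasureTheory ProbabilityTheory Finset Filter Topology
open scoped ENNReal BigOperators
open Literature.MathematicalPhysics.KineticTheory Literature.MathematicalPhysics.StatisticalMechanics
open Literature.Probability.LatticeModels

/-- `∑_{j<m} (j+1)(j+2) θʲ ≤ 4` for `0 ≤ θ ≤ 1/8` (domination by `2 · 2⁻ʲ`: `j + 1 ≤ 2ʲ`). [folklore] -/
theorem tlv_sum_le {θ : ℝ} (hθ0 : 0 ≤ θ) (hθ : θ ≤ 1 / 8) (m : ℕ) :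
    ∑ j ∈ range m, ((j : ℝ) + 1) * ((j : ℝ) + 2) * θ ^ j ≤ 4 := by
  have hterm : ∀ j ∈ range m, ((j : ℝ) + 1) * ((j : ℝ) + 2) * θ ^ j ≤ 2 * (1 / 2 : ℝ) ^ j := by
    intro j _
    have h1 : (j : ℝ) + 1 ≤ 2 ^ j := by exact_mod_cast Nat.succ_le_of_lt Nat.lt_two_pow_self
    have h1' : (1 : ℝ) ≤ 2 ^ j := one_le_pow₀ (by norm_num)
    have h4 : (2 * 2 * θ) ^ j ≤ (1 / 2 : ℝ) ^ j := pow_le_pow_left₀ (by positivity) (by linarith) j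
    calc ((j : ℝ) + 1) * ((j : ℝ) + 2) * θ ^ j ≤ 2 ^ j * (2 * 2 ^ j) * θ ^ j :=
          mul_le_mul_of_nonneg_right (mul_le_mul h1 (by linarith) (by positivity) (by positivity)) (pow_nonneg hθ0 j)
      _ = 2 * (2 * 2 * θ) ^ j := by rw [mul_pow, mul_pow]; ring
      _ ≤ 2 * (1 / 2 : ℝ) ^ j := by linarith
  calc ∑ j ∈ range m, ((j : ℝ) + 1) * ((j : ℝ) + 2) * θ ^ j ≤ ∑ j ∈ range m, 2 * (1 / 2 : ℝ) ^ j := sum_le_sum hterm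
    _ = 2 * ∑ j ∈ range m, (1 / 2 : ℝ) ^ j := by rw [mul_sum]
    _ ≤ 2 * 2 := mul_le_mul_of_nonneg_left (sum_geometric_two_le m) (by norm_num)
    _ = 4 := by norm_num

/-- Domination of a finite sum: if `tⱼ ≤ c (j+1)(j+2) θʲ` (`0 ≤ c`, `0 ≤ θ ≤ 1/8`) then `Σ_{j<m} tⱼ ≤ 4c`. [folklore] -/
theorem tlv_sum_dom {θ c : ℝ} (hθ0 : 0 ≤ θ) (hθ : θ ≤ 1 / 8) (hc : 0 ≤ c) {m : ℕ} {t : ℕ → ℝ}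
    (h : ∀ j ∈ range m, t j ≤ c * (((j : ℝ) + 1) * ((j : ℝ) + 2) * θ ^ j)) : ∑ j ∈ range m, t j ≤ 4 * c := by
  refine (sum_le_sum h).trans ?_
  rw [← mul_sum]
  nlinarith [tlv_sum_le hθ0 hθ m]

/-- `(∫ |g| dμ)² ≤ ∫ g² dμ` for the probability measure `μ_P` (the variance of `|g|` is non-negative). [folklore] -/
theorem tlv_sq_integral_abs_le (P : DensityProfile) {g : T3 → ℝ} (hg : Measurable g) {C : ℝ}
    (hgC : ∀ y, |g y| ≤ C) : (∫ y, |g y| ∂P.μ) ^ 2 ≤ ∫ y, g y ^ 2 ∂P.μ := by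
  have hX : MemLp (fun y => |g y|) 2 P.μ := MemLp.of_bound hg.abs.aestronglyMeasurable C
    (ae_of_all _ fun y => by rw [Real.norm_eq_abs, abs_abs]; exact hgC y)
  have h := variance_nonneg (fun y => |g y|) P.μ
  rw [variance_eq_sub hX] at h
  simp only [Pi.pow_apply, sq_abs] at h
  linarith

section Bounds

variable {P : DensityProfile} {e lam : ℝ} {n : ℕ}
  (he : 0 ≤ e) (he2 : e < 1 / 2) (hnp : (n : ℝ) * pOv P e ≤ lam) (hlam : lam ≤ 1 / 50)
include he he2 hnp

/-- **`L¹` coefficient bound**: `C(m, j) |W^g(j+1)| ≤ (∫|g| dμ) e (eλ)ʲ` for `j < n`, `m ≤ n`, `n p_ε ≤ λ`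
(the `L¹` tree bound `MesoLLN.abs_Wd_le_integral` and `C(m, j) ≤ mʲ/j!`). [folklore] -/
theorem tlv_choose_mul_abs_Wd_le [NeZero n] {g : T3 → ℝ} (hg : Measurable g) {C : ℝ} (hgC : ∀ y, |g y| ≤ C)
    {m j : ℕ} (hj : j < n) (hm : m ≤ n) :
    (m.choose j : ℝ) * |Wd P e n g (j + 1)| ≤ (∫ y, |g y| ∂P.μ) * (Real.exp 1 * (Real.exp 1 * lam) ^ j) := by
  have hI : 0 ≤ ∫ y, |g y| ∂P.μ := integral_nonneg fun _ => abs_nonneg _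
  have hp : 0 ≤ pOv P e := pOv_nonneg P he
  have hlam0 : 0 ≤ lam := gf_lam_nonneg hnp he
  have hW := MesoLLN.abs_Wd_le_integral (P := P) (n := n) he he2 hg hgC (k := j + 1) (by omega) (by omega)
  rw [Nat.add_sub_cancel] at hW
  have hchoose : (m.choose j : ℝ) ≤ (m : ℝ) ^ j / j.factorial := Nat.choose_le_pow_div j m
  have hmp : (m : ℝ) * pOv P e ≤ lam := le_trans (mul_le_mul_of_nonneg_right (by exact_mod_cast hm) hp) hnp
  have hmp0 : 0 ≤ (m : ℝ) * pOv P e := by positivity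
  calc (m.choose j : ℝ) * |Wd P e n g (j + 1)|
      ≤ ((m : ℝ) ^ j / j.factorial) * ((∫ y, |g y| ∂P.μ) * (treeNumber (j + 1) * pOv P e ^ j)) :=
        mul_le_mul hchoose hW (abs_nonneg _) (by positivity)
    _ = (∫ y, |g y| ∂P.μ) * ((treeNumber (j + 1) : ℝ) * ((m : ℝ) * pOv P e) ^ j / j.factorial) := by
        rw [mul_pow]; ring
    _ ≤ (∫ y, |g y| ∂P.μ) * ((treeNumber (j + 1) : ℝ) * lam ^ j / j.factorial) := by gcongr
    _ ≤ (∫ y, |g y| ∂P.μ) * (Real.exp 1 * (Real.exp 1 * lam) ^ j) :=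
        mul_le_mul_of_nonneg_left (treeNumber_succ_mul_pow_div_factorial_le hlam0 j) hI

include hlam

/-- **Crude one-point bound**: `|M^g(m)/Ξ(m)| ≤ 2 ∫|g| dμ` for `1 ≤ m ≤ n` (`|M^g| ≤ M^{|g|}`, Ruelle's bound
`M^{|g|}(m) ≤ (∫|g|) Ξ(m-1)` and `Ξ(m-1)/Ξ(m) ≤ 2`). [folklore] -/
theorem tlv_abs_onePt_le [NeZero n] {g : T3 → ℝ} (hg : Measurable g) {C : ℝ} (hgC : ∀ y, |g y| ≤ C)
    {m : ℕ} (hm1 : 1 ≤ m) (hmn : m ≤ n) : |Md P e n g m / Xi P e n m| ≤ 2 * ∫ y, |g y| ∂P.μ := by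
  have hlam1 : lam < 1 := by linarith
  have hXm := gf_Xi_pos he he2 hnp hlam1 hmn
  have hMd := LGFS.Md_le_integral_mul_Xi (P := P) (ε := e) (n := n) hg.abs (C := C)
    (fun y => by rw [abs_abs]; exact hgC y) (fun y => abs_nonneg _) hm1 hmn
  have hq := gf_q_le_two he he2 hnp hlam1 (by linarith) (m := m - 1) (by omega)
  rw [Nat.sub_add_cancel hm1, div_le_iff₀ hXm] at hq
  have hI : 0 ≤ ∫ y, |g y| ∂P.μ := integral_nonneg fun _ => abs_nonneg _
  have habs : |Md P e n g m| ≤ Md P e n (fun y => |g y|) m := by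
    rw [Md, Md, decPF, decPF]
    refine abs_integral_le_integral_abs.trans (le_of_eq (integral_congr_ae (ae_of_all _ fun x => ?_)))
    beta_reduce
    rw [abs_mul, abs_of_nonneg (efR_nonneg x _)]
  rw [abs_div, abs_of_pos hXm, div_le_iff₀ hXm]
  calc |Md P e n g m| ≤ (∫ y, |g y| ∂P.μ) * Xi P e n (m - 1) := habs.trans hMd
    _ ≤ (∫ y, |g y| ∂P.μ) * (2 * Xi P e n m) := mul_le_mul_of_nonneg_left hq hI
    _ = 2 * (∫ y, |g y| ∂P.μ) * Xi P e n m := by ring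

/-- **Telescoped shift bound**: if `|A(m+1) - A(m)| ≤ K'(∫|g|)/m` for `2 ≤ m < n` (`A(m) = M^g(m)/Ξ(m)`) and `4 ≤ K'`,
then `|A(m+d) - A(m)| ≤ K' (∫|g|) d/m` for `1 ≤ m`, `m + d ≤ n` (the step at level `1` by `|A| ≤ 2∫|g|`). [folklore] -/
theorem tlv_tele [NeZero n] {g : T3 → ℝ} (hg : Measurable g) {C : ℝ} (hgC : ∀ y, |g y| ≤ C) {K' : ℝ}
    (hK4 : 4 ≤ K')
    (hstep : ∀ m : ℕ, 2 ≤ m → m < n →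
      |Md P e n g (m + 1) / Xi P e n (m + 1) - Md P e n g m / Xi P e n m| ≤ K' * (∫ y, |g y| ∂P.μ) / (m : ℝ))
    {m : ℕ} (hm1 : 1 ≤ m) {d : ℕ} (hd : m + d ≤ n) :
    |Md P e n g (m + d) / Xi P e n (m + d) - Md P e n g m / Xi P e n m| ≤ K' * (∫ y, |g y| ∂P.μ) * d / (m : ℝ) := by
  have hI : 0 ≤ ∫ y, |g y| ∂P.μ := integral_nonneg fun _ => abs_nonneg _
  induction d with
  | zero => simp
  | succ d ih =>
    have hm0 : (0 : ℝ) < m := by exact_mod_cast hm1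
    have hs : |Md P e n g (m + d + 1) / Xi P e n (m + d + 1) - Md P e n g (m + d) / Xi P e n (m + d)| ≤
        K' * (∫ y, |g y| ∂P.μ) / m := by
      rcases Nat.lt_or_ge (m + d) 2 with h | h
      · have h1 := tlv_abs_onePt_le he he2 hnp hlam hg hgC (m := m + d + 1) (by omega) (by omega)
        have h0 := tlv_abs_onePt_le he he2 hnp hlam hg hgC (m := m + d) (by omega) (by omega)
        obtain rfl : m = 1 := by omega
        rw [Nat.cast_one, div_one]
        calc _ ≤ _ := abs_sub _ _
          _ ≤ 2 * (∫ y, |g y| ∂P.μ) + 2 * (∫ y, |g y| ∂P.μ) := add_le_add h1 h0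
          _ ≤ K' * ∫ y, |g y| ∂P.μ := by nlinarith
      · exact (hstep (m + d) h (by omega)).trans (div_le_div_of_nonneg_left (by nlinarith) hm0
          (by push_cast; linarith [(Nat.cast_nonneg d : (0 : ℝ) ≤ d)]))
    rw [← add_assoc]
    calc _ ≤ |Md P e n g (m + d + 1) / Xi P e n (m + d + 1) - Md P e n g (m + d) / Xi P e n (m + d)| +
          |Md P e n g (m + d) / Xi P e n (m + d) - Md P e n g m / Xi P e n m| := abs_sub_le _ _ _
      _ ≤ K' * (∫ y, |g y| ∂P.μ) / m + K' * (∫ y, |g y| ∂P.μ) * d / m := add_le_add hs (ih (by omega))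
      _ = K' * (∫ y, |g y| ∂P.μ) * ((d + 1 : ℕ) : ℝ) / m := by push_cast; ring

/-- **(B1) The shifted one-point expectations**:
`n |Σ_{j<n-1} C(n-2,j) W(j+1) Ξ(n-1-j) (A(n-1-j) - A(n))| ≤ 8 e K' (∫|g|)² Ξ(n)` (the `L¹` coefficient bound,
`Ξ(n-1-j) ≤ 2^{j+1} Ξ(n)`, the telescoped shift bound with `(j+2)(n-1-j) ≥ n`, and `Σ (j+1)(j+2)(2eλ)ʲ ≤ 4`). [folklore] -/
theorem tlv_B1 [NeZero n] {g : T3 → ℝ} (hg : Measurable g) {C : ℝ} (hgC : ∀ y, |g y| ≤ C) {K' : ℝ}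
    (hK4 : 4 ≤ K')
    (hstep : ∀ m : ℕ, 2 ≤ m → m < n →
      |Md P e n g (m + 1) / Xi P e n (m + 1) - Md P e n g m / Xi P e n m| ≤ K' * (∫ y, |g y| ∂P.μ) / (m : ℝ)) :
    (n : ℝ) * |∑ j ∈ range (n - 1), ((n - 2).choose j : ℝ) * Wd P e n g (j + 1) *
        (Xi P e n (n - 1 - j) * (Md P e n g (n - 1 - j) / Xi P e n (n - 1 - j) - Md P e n g n / Xi P e n n))| ≤
      8 * Real.exp 1 * K' * (∫ y, |g y| ∂P.μ) ^ 2 * Xi P e n n := by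
  have hlam1 : lam < 1 := by linarith
  have hlam0 : 0 ≤ lam := gf_lam_nonneg hnp he
  have hI : 0 ≤ ∫ y, |g y| ∂P.μ := integral_nonneg fun _ => abs_nonneg _
  have hKI : 0 ≤ K' * ∫ y, |g y| ∂P.μ := mul_nonneg (by linarith) hI
  have hΞ : 0 < Xi P e n n := gf_Xi_pos he he2 hnp hlam1 le_rfl
  have hθ8 : 2 * Real.exp 1 * lam ≤ 1 / 8 := by nlinarith [Real.exp_one_lt_d9, Real.exp_pos 1]
  have hterm : ∀ j ∈ range (n - 1), (n : ℝ) * |((n - 2).choose j : ℝ) * Wd P e n g (j + 1) *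
      (Xi P e n (n - 1 - j) * (Md P e n g (n - 1 - j) / Xi P e n (n - 1 - j) - Md P e n g n / Xi P e n n))| ≤
        (2 * Real.exp 1 * K' * (∫ y, |g y| ∂P.μ) ^ 2 * Xi P e n n) *
          (((j : ℝ) + 1) * ((j : ℝ) + 2) * (2 * Real.exp 1 * lam) ^ j) := by
    intro j hj
    have hj' : j < n - 1 := mem_range.1 hj
    have ha := tlv_choose_mul_abs_Wd_le he he2 hnp hg hgC (m := n - 2) (j := j) (by omega) (Nat.sub_le n 2)
    have hr := gf_r_le_two_pow he he2 hnp hlam1 (by linarith) (m := n) le_rfl (j := j + 1) (by omega)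
    rw [show n - (j + 1) = n - 1 - j by omega, div_le_iff₀ hΞ] at hr
    -- the telescoped shift bound, `(j+2)(n-1-j) ≥ n`
    have h := tlv_tele he he2 hnp hlam hg hgC hK4 hstep (m := n - 1 - j) (by omega) (d := j + 1) (by omega)
    rw [show n - 1 - j + (j + 1) = n by omega, abs_sub_comm] at h
    have hm0 : (0 : ℝ) < ((n - 1 - j : ℕ) : ℝ) := by exact_mod_cast (show 0 < n - 1 - j by omega)
    have hM1 : (1 : ℝ) ≤ ((n - 1 - j : ℕ) : ℝ) := by exact_mod_cast (show 1 ≤ n - 1 - j by omega)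
    have hn : (n : ℝ) = ((n - 1 - j : ℕ) : ℝ) + j + 1 := by exact_mod_cast (show n = n - 1 - j + j + 1 by omega)
    have hc : (n : ℝ) * |Md P e n g (n - 1 - j) / Xi P e n (n - 1 - j) - Md P e n g n / Xi P e n n| ≤
        K' * (∫ y, |g y| ∂P.μ) * (((j : ℝ) + 1) * ((j : ℝ) + 2)) := by
      refine (mul_le_mul_of_nonneg_left h (Nat.cast_nonneg n)).trans ?_
      rw [mul_div_assoc', div_le_iff₀ hm0, hn]
      push_cast
      nlinarith [mul_nonneg (mul_nonneg hKI (sq_nonneg ((j : ℝ) + 1))) (sub_nonneg.2 hM1)]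
    rw [abs_mul, abs_mul, abs_mul, Nat.abs_cast, abs_of_nonneg (Xi_nonneg _)]
    calc (n : ℝ) * (((n - 2).choose j : ℝ) * |Wd P e n g (j + 1)| * (Xi P e n (n - 1 - j) *
          |Md P e n g (n - 1 - j) / Xi P e n (n - 1 - j) - Md P e n g n / Xi P e n n|))
        = ((n - 2).choose j : ℝ) * |Wd P e n g (j + 1)| * Xi P e n (n - 1 - j) *
            ((n : ℝ) * |Md P e n g (n - 1 - j) / Xi P e n (n - 1 - j) - Md P e n g n / Xi P e n n|) := by ring
      _ ≤ (∫ y, |g y| ∂P.μ) * (Real.exp 1 * (Real.exp 1 * lam) ^ j) * (2 ^ (j + 1) * Xi P e n n) *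
            (K' * (∫ y, |g y| ∂P.μ) * (((j : ℝ) + 1) * ((j : ℝ) + 2))) :=
          mul_le_mul (mul_le_mul ha hr (Xi_nonneg _) (by positivity)) hc (by positivity) (by positivity)
      _ = (2 * Real.exp 1 * K' * (∫ y, |g y| ∂P.μ) ^ 2 * Xi P e n n) *
          (((j : ℝ) + 1) * ((j : ℝ) + 2) * (2 * Real.exp 1 * lam) ^ j) := by
          simp only [mul_pow, pow_succ]
          ring
  calc _ ≤ (n : ℝ) * ∑ j ∈ range (n - 1), |((n - 2).choose j : ℝ) * Wd P e n g (j + 1) *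
          (Xi P e n (n - 1 - j) * (Md P e n g (n - 1 - j) / Xi P e n (n - 1 - j) - Md P e n g n / Xi P e n n))| :=
        mul_le_mul_of_nonneg_left (abs_sum_le_sum_abs _ _) (Nat.cast_nonneg n)
    _ = ∑ j ∈ range (n - 1), (n : ℝ) * |((n - 2).choose j : ℝ) * Wd P e n g (j + 1) *
          (Xi P e n (n - 1 - j) * (Md P e n g (n - 1 - j) / Xi P e n (n - 1 - j) - Md P e n g n / Xi P e n n))| := by
        rw [mul_sum]
    _ ≤ 4 * (2 * Real.exp 1 * K' * (∫ y, |g y| ∂P.μ) ^ 2 * Xi P e n n) :=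
        tlv_sum_dom (by positivity) hθ8 (by positivity) hterm
    _ = _ := by ring

/-- **(B3) The same-block majorant over the partition function**:
`n Σ_{j<n-1} C(n-2,j) t(j+2) p_ε^{j+1} Ξ(n-2-j) ≤ 16 e² λ Ξ(n)` (it carries the extra factor `n p_ε ≤ λ`). [folklore] -/
theorem tlv_B3 : (n : ℝ) * ∑ j ∈ range (n - 1), ((n - 2).choose j : ℝ) *
      (treeNumber (j + 2) * pOv P e ^ (j + 1) * Xi P e n (n - 2 - j)) ≤ 16 * Real.exp 1 ^ 2 * lam * Xi P e n n := by
  have hlam1 : lam < 1 := by linarith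
  have hlam0 : 0 ≤ lam := gf_lam_nonneg hnp he
  have hp : 0 ≤ pOv P e := pOv_nonneg P he
  have hΞ : 0 < Xi P e n n := gf_Xi_pos he he2 hnp hlam1 le_rfl
  have hθ8 : 2 * Real.exp 1 * lam ≤ 1 / 8 := by nlinarith [Real.exp_one_lt_d9, Real.exp_pos 1]
  have hterm : ∀ j ∈ range (n - 1),
      (n : ℝ) * (((n - 2).choose j : ℝ) * (treeNumber (j + 2) * pOv P e ^ (j + 1) * Xi P e n (n - 2 - j))) ≤
        (4 * Real.exp 1 ^ 2 * lam * Xi P e n n) * (((j : ℝ) + 1) * ((j : ℝ) + 2) * (2 * Real.exp 1 * lam) ^ j) := by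
    intro j hj
    have hj' : j < n - 1 := mem_range.1 hj
    have hr := gf_r_le_two_pow he he2 hnp hlam1 (by linarith) (m := n) le_rfl (j := j + 2) (by omega)
    rw [show n - (j + 2) = n - 2 - j by omega, div_le_iff₀ hΞ] at hr
    have hchoose : ((n - 2).choose j : ℝ) ≤ (n : ℝ) ^ j / j.factorial :=
      (Nat.choose_le_pow_div j (n - 2)).trans (div_le_div_of_nonneg_right
        (pow_le_pow_left₀ (Nat.cast_nonneg _) (by exact_mod_cast Nat.sub_le n 2) j) (by positivity))
    have hnp0 : 0 ≤ (n : ℝ) * pOv P e := by positivity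
    have hct : ((n - 2).choose j : ℝ) * (treeNumber (j + 2) * pOv P e ^ j) ≤
        Real.exp 1 ^ 2 * (j + 1) * (Real.exp 1 * lam) ^ j := by
      calc ((n - 2).choose j : ℝ) * (treeNumber (j + 2) * pOv P e ^ j)
          ≤ ((n : ℝ) ^ j / j.factorial) * (treeNumber (j + 2) * pOv P e ^ j) :=
            mul_le_mul_of_nonneg_right hchoose (by positivity)
        _ = (treeNumber (j + 2) : ℝ) * ((n : ℝ) * pOv P e) ^ j / j.factorial := by rw [mul_pow]; ring
        _ ≤ (treeNumber (j + 2) : ℝ) * lam ^ j / j.factorial := by gcongr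
        _ ≤ Real.exp 1 ^ 2 * (j + 1) * (Real.exp 1 * lam) ^ j := treeNumber_succ_succ_mul_pow_div_factorial_le hlam0 j
    have hjj : ((j : ℝ) + 1) * (2 * Real.exp 1 * lam) ^ j ≤ ((j : ℝ) + 1) * ((j : ℝ) + 2) * (2 * Real.exp 1 * lam) ^ j :=
      mul_le_mul_of_nonneg_right (by nlinarith [(Nat.cast_nonneg j : (0 : ℝ) ≤ j)]) (by positivity)
    have hΞ'' : 0 ≤ Xi P e n (n - 2 - j) := Xi_nonneg _
    calc (n : ℝ) * (((n - 2).choose j : ℝ) * (treeNumber (j + 2) * pOv P e ^ (j + 1) * Xi P e n (n - 2 - j)))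
        = ((n : ℝ) * pOv P e) * ((((n - 2).choose j : ℝ) * (treeNumber (j + 2) * pOv P e ^ j)) *
            Xi P e n (n - 2 - j)) := by rw [pow_succ]; ring
      _ ≤ lam * ((Real.exp 1 ^ 2 * (j + 1) * (Real.exp 1 * lam) ^ j) * (2 ^ (j + 2) * Xi P e n n)) :=
          mul_le_mul hnp (mul_le_mul hct hr hΞ'' (by positivity)) (by positivity) hlam0
      _ = (4 * Real.exp 1 ^ 2 * lam * Xi P e n n) * (((j : ℝ) + 1) * (2 * Real.exp 1 * lam) ^ j) := by
          simp only [mul_pow, pow_succ]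
          ring
      _ ≤ (4 * Real.exp 1 ^ 2 * lam * Xi P e n n) * (((j : ℝ) + 1) * ((j : ℝ) + 2) * (2 * Real.exp 1 * lam) ^ j) :=
          mul_le_mul_of_nonneg_left hjj (by positivity)
  rw [mul_sum]
  exact (tlv_sum_dom (by positivity) hθ8 (by positivity) hterm).trans_eq (by ring)

end Bounds

/-- **THE `L²` VARIANCE BOUND** `Var(Σᵢ g(xᵢ)) ≤ K n ∫ g² dμ` for linear statistics of the canonical dilute hard-sphere gas
(`VarianceL2`), from the one-point shift bound `OnePointShift` and the `L²` same-block bound `SameBlockL2`: the variance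
identity, `E[g²] ≤ 2 ∫ g²`, and the cross term `Ξ(n)(T - A²) = Σ_j C(n-2,j) W(j+1) Ξ(n-1-j)(A(n-1-j) - A) + sbr(g,g) - A sbr(g,1)`
(`λ₀ = min λ_s (1/50)`, `K = 2 + 8eK' + 48e²`, `K' = max K_s 4`). [cite: PulvirentiTsagkarogiannis2012, Thm 2.1] -/
theorem tl_varianceL2_of : OnePointShift → SameBlockL2 → VarianceL2 := by
  intro hS hB
  obtain ⟨lam_s, hlam_s, K_s, _, hshift⟩ := hS
  obtain ⟨K', hK4, hKs⟩ : ∃ K' : ℝ, 4 ≤ K' ∧ K_s ≤ K' := ⟨max K_s 4, le_max_right _ _, le_max_left _ _⟩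
  have hK0 : 0 < K' := by linarith
  refine ⟨min lam_s (1 / 50), lt_min hlam_s (by norm_num), 2 + (8 * Real.exp 1 * K' + 48 * Real.exp 1 ^ 2),
    by positivity, ?_⟩
  intro P e he he2 n _ h2 hnp g hg hg1
  have hlam : min lam_s (1 / 50) ≤ 1 / 50 := min_le_right _ _
  have hlam1 : min lam_s (1 / 50) < 1 := by linarith
  have hl1 : min lam_s (1 / 50) ≤ 1 := by linarith
  have hlam0 : 0 ≤ min lam_s (1 / 50) := gf_lam_nonneg hnp he
  have hnps : (n : ℝ) * pOv P e ≤ lam_s := hnp.trans (min_le_left _ _)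
  have h1n : 1 ≤ n := by omega
  have hn : (n : ℝ) ≠ 0 := by exact_mod_cast NeZero.ne n
  have h1r : (1 : ℝ) ≤ n := by exact_mod_cast h1n
  have hΞ : 0 < Xi P e n n := gf_Xi_pos he he2 hnp hlam1 le_rfl
  have hI : 0 ≤ ∫ y, |g y| ∂P.μ := integral_nonneg fun _ => abs_nonneg _
  have hI2 : 0 ≤ ∫ y, g y ^ 2 ∂P.μ := integral_nonneg fun _ => sq_nonneg _
  have hII : (∫ y, |g y| ∂P.μ) ^ 2 ≤ ∫ y, g y ^ 2 ∂P.μ := tlv_sq_integral_abs_le P hg hg1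
  have hstep : ∀ m : ℕ, 2 ≤ m → m < n →
      |Md P e n g (m + 1) / Xi P e n (m + 1) - Md P e n g m / Xi P e n m| ≤
        K' * (∫ y, |g y| ∂P.μ) / (m : ℝ) := fun m hm hmn =>
    (hshift P e he he2 n hnps g hg 1 hg1 m hm hmn).trans
      (div_le_div_of_nonneg_right (mul_le_mul_of_nonneg_right hKs hI) (Nat.cast_nonneg m))
  -- the pieces
  have hA2 := tlv_abs_onePt_le he he2 hnp hlam hg hg1 h1n le_rfl
  have hB1 := tlv_B1 he he2 hnp hlam hg hg1 hK4 hstep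
  have hB3 := (tlv_B3 he he2 hnp (n := n) hlam).trans
    (mul_le_mul_of_nonneg_right (mul_le_of_le_one_right (by positivity) hl1) hΞ.le)
  have hsb := hB P e he he2 n h2 g hg 1 hg1
  have hsb1 := LGFS.abs_sameBlockRem_le_L1 (P := P) (n := n) h2 he he2 hg measurable_const hg1 (C' := 1)
    (h := fun _ => 1) (fun _ => by simp)
  have hE2 : Md P e n (fun y => g y ^ 2) n / Xi P e n n ≤ 2 * ∫ y, g y ^ 2 ∂P.μ := by
    have hMd := LGFS.Md_le_integral_mul_Xi (P := P) (ε := e) (n := n) (hg.pow_const 2) (C := 1)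
      (fun y => by rw [abs_pow]; exact pow_le_one₀ (abs_nonneg _) (hg1 y)) (fun y => sq_nonneg _) h1n le_rfl
    have hq := gf_q_le_two he he2 hnp hlam1 (by linarith) (m := n - 1) (by omega)
    rw [Nat.sub_add_cancel h1n, div_le_iff₀ hΞ] at hq
    rw [div_le_iff₀ hΞ]
    exact hMd.trans ((mul_le_mul_of_nonneg_left hq hI2).trans_eq (by ring))
  -- the two-point expansions of `∫ g(x₀) g(x₁) 𝟙` and of `M^g(n) = ∫ g(x₀) · 1 · 𝟙`
  have hT := integral_two_point_eq (P := P) (ε := e) h2 hg hg hg1 hg1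
  have hM := integral_two_point_eq (P := P) (ε := e) h2 hg measurable_const hg1 (C' := 1) (h := fun _ => 1)
    (fun _ => by simp)
  simp only [mul_one, Md_one] at hM
  rw [integral_mul_efR_eq_Md P e hg] at hM
  -- the variance identity, rescaled by `n²`
  have hvar := variance_identity P e h2 hg hg1 (Md P e n g n / Xi P e n n) hΞ.ne'
  have hint : ∫ x, (∑ i, g (x i) - (n : ℝ) * (Md P e n g n / Xi P e n n)) ^ 2 * efR (Ov e) x univ
        ∂Measure.pi (fun _ : Fin n => P.μ) =
      (n : ℝ) ^ 2 * ∫ x, ((n : ℝ)⁻¹ * ∑ i, g (x i) - Md P e n g n / Xi P e n n) ^ 2 * efR (Ov e) x univ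
        ∂Measure.pi (fun _ : Fin n => P.μ) := by
    rw [← integral_const_mul]
    refine integral_congr_ae (ae_of_all _ fun x => ?_)
    beta_reduce
    have h : (n : ℝ) * ((n : ℝ)⁻¹ * ∑ i, g (x i) - Md P e n g n / Xi P e n n) =
        ∑ i, g (x i) - (n : ℝ) * (Md P e n g n / Xi P e n n) := by
      rw [mul_sub, ← mul_assoc, mul_inv_cancel₀ hn, one_mul]
    rw [← h]
    ring
  rw [hint, mul_div_assoc, hvar]
  -- the cross term `n |T - A²| ≤ Kc ∫ g²`; name `Tint = ∫ g(x₀)g(x₁)𝟙` and `A = A(n)`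
  have hD : (∫ x, g (x 0) * g (x ⟨1, h2⟩) * efR (Ov e) x univ ∂Measure.pi (fun _ : Fin n => P.μ)) / Xi P e n n -
      (Md P e n g n / Xi P e n n) ^ 2 = ((∫ x, g (x 0) * g (x ⟨1, h2⟩) * efR (Ov e) x univ
        ∂Measure.pi (fun _ : Fin n => P.μ)) - Md P e n g n / Xi P e n n * Md P e n g n) / Xi P e n n := by
    field_simp
  generalize (∫ x, g (x 0) * g (x ⟨1, h2⟩) * efR (Ov e) x univ ∂Measure.pi (fun _ : Fin n => P.μ)) = Tint at hT hD ⊢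
  generalize Md P e n g n / Xi P e n n = A at hA2 hB1 hD ⊢
  have hY : Tint - A * Md P e n g n = (∑ j ∈ range (n - 1), ((n - 2).choose j : ℝ) * Wd P e n g (j + 1) *
      (Xi P e n (n - 1 - j) * (Md P e n g (n - 1 - j) / Xi P e n (n - 1 - j) - A))) +
        (sameBlockRem P e n h2 g g - A * sameBlockRem P e n h2 g (fun _ => 1)) := by
    rw [hT, hM, mul_add, mul_sum, add_sub_add_comm, ← sum_sub_distrib]
    congr 1
    refine sum_congr rfl fun j hj => ?_
    have hΞ' := (gf_Xi_pos he he2 hnp hlam1 (show n - 1 - j ≤ n by omega)).ne'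
    rw [mul_sub, mul_div_cancel₀ _ hΞ']
    ring
  generalize (∑ j ∈ range (n - 1), ((n - 2).choose j : ℝ) * Wd P e n g (j + 1) *
      (Xi P e n (n - 1 - j) * (Md P e n g (n - 1 - j) / Xi P e n (n - 1 - j) - A))) = X₁ at hB1 hY
  have hcross : (n : ℝ) * |Tint / Xi P e n n - A ^ 2| ≤
      (8 * Real.exp 1 * K' + 48 * Real.exp 1 ^ 2) * ∫ y, g y ^ 2 ∂P.μ := by
    rw [hD, hY, abs_div, abs_of_pos hΞ, mul_div_assoc', div_le_iff₀ hΞ]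
    have hsbn : (n : ℝ) * |sameBlockRem P e n h2 g g| ≤ (∫ y, g y ^ 2 ∂P.μ) * (16 * Real.exp 1 ^ 2 * Xi P e n n) :=
      (mul_le_mul_of_nonneg_left hsb (Nat.cast_nonneg n)).trans
        (by rw [mul_left_comm]; exact mul_le_mul_of_nonneg_left hB3 hI2)
    have hsb1n : (n : ℝ) * |A * sameBlockRem P e n h2 g (fun _ => 1)| ≤
        (2 * ∫ y, |g y| ∂P.μ) * ((∫ y, |g y| ∂P.μ) * (16 * Real.exp 1 ^ 2 * Xi P e n n)) := by
      rw [abs_mul, mul_left_comm]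
      refine mul_le_mul hA2 ((mul_le_mul_of_nonneg_left hsb1 (Nat.cast_nonneg n)).trans ?_) (by positivity)
        (by positivity)
      rw [mul_one, mul_left_comm]
      exact mul_le_mul_of_nonneg_left hB3 hI
    have hf : (8 * Real.exp 1 * K' + 32 * Real.exp 1 ^ 2) * Xi P e n n * (∫ y, |g y| ∂P.μ) ^ 2 ≤
        (8 * Real.exp 1 * K' + 32 * Real.exp 1 ^ 2) * Xi P e n n * ∫ y, g y ^ 2 ∂P.μ :=
      mul_le_mul_of_nonneg_left hII (by positivity)
    have htri : |X₁ + (sameBlockRem P e n h2 g g - A * sameBlockRem P e n h2 g (fun _ => 1))| ≤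
        |X₁| + (|sameBlockRem P e n h2 g g| + |A * sameBlockRem P e n h2 g (fun _ => 1)|) :=
      (abs_add_le _ _).trans (add_le_add le_rfl (abs_sub _ _))
    have := mul_le_mul_of_nonneg_left htri (Nat.cast_nonneg n)
    linarith only [this, hB1, hsbn, hsb1n, hf]
  -- assembly
  have halg : (n : ℝ) ^ 2 * ((n : ℝ)⁻¹ * (Md P e n (fun y => g y ^ 2) n / Xi P e n n) + (1 - (n : ℝ)⁻¹) *
      (Tint / Xi P e n n) - 2 * A * A + A ^ 2) = (n : ℝ) * (Md P e n (fun y => g y ^ 2) n / Xi P e n n) +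
        ((n : ℝ) ^ 2 - n) * (Tint / Xi P e n n - A ^ 2) - (n : ℝ) * A ^ 2 := by
    field_simp
    ring
  rw [halg]
  have h1 : (n : ℝ) * (Md P e n (fun y => g y ^ 2) n / Xi P e n n) ≤ (n : ℝ) * (2 * ∫ y, g y ^ 2 ∂P.μ) :=
    mul_le_mul_of_nonneg_left hE2 (Nat.cast_nonneg n)
  have hnn : (0 : ℝ) ≤ (n : ℝ) ^ 2 - n := by
    have := mul_nonneg (Nat.cast_nonneg n : (0 : ℝ) ≤ n) (sub_nonneg.2 h1r)
    linarith only [this]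
  have h2' : ((n : ℝ) ^ 2 - n) * (Tint / Xi P e n n - A ^ 2) ≤
      (n : ℝ) * ((8 * Real.exp 1 * K' + 48 * Real.exp 1 ^ 2) * ∫ y, g y ^ 2 ∂P.μ) :=
    calc ((n : ℝ) ^ 2 - n) * (Tint / Xi P e n n - A ^ 2) ≤ ((n : ℝ) ^ 2 - n) * |Tint / Xi P e n n - A ^ 2| :=
          mul_le_mul_of_nonneg_left (le_abs_self _) hnn
      _ ≤ (n : ℝ) ^ 2 * |Tint / Xi P e n n - A ^ 2| :=
          mul_le_mul_of_nonneg_right (by linarith only [h1r]) (abs_nonneg _)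
      _ = (n : ℝ) * ((n : ℝ) * |Tint / Xi P e n n - A ^ 2|) := by ring
      _ ≤ _ := mul_le_mul_of_nonneg_left hcross (Nat.cast_nonneg n)
  have h3 : 0 ≤ (n : ℝ) * A ^ 2 := by positivity
  linarith only [h1, h2', h3]

end Summit.AtomisticToContinuum.HydrodynamicLimit.Theorems.NearConstantShortTimeHL

end
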